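import Summits.QuantumFields.YangMills.Theorems.BalabanUVNodesN15KingModelCarriers
import Summits.QuantumFields.YangMills.Theorems.BalabanUVNodesSpineRates
import Literature.MathematicalPhysics.QuantumFieldTheory.Balaban1983to89.T4EtaRateUnitWitness
import Literature.MathematicalPhysics.QuantumFieldTheory.Balaban1983to89.T4EtaRateSiteOfRatePair

/-!
# Route «BalabanUVNodes» (K4 «SpineRates»), node N15 = NE2 — THE KING-MODEL RUNG, part 2∕2 (`NE2_in_KingModel`): the node's face `N15At`
# (`NE2PlusOperator ∧ NE2PlusSite 4 p ∧ NE2PlusUnit` on ONE family) DECIDED IN KING'S A = 0 SCALAR MODEL — all three layers inhabited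
# hypothesis-free by King's ACTUAL unit-lattice covariances `C^{(k)} = (Δ^{(k)} + aL⁻²Q*Q)⁻¹` on every torus, Lemma 4.5 (4.38) as THE kernel

Cell `pub-ymgap`, Track A (D-0062), seat `pub-ymgap-dag-n15-d` (R134 seat, strategy s3; director-ym R134 row «assemble `T4EtaRate.NE2PlusOperator` :250 ∕
`NE2PlusUnit` :265 … with King 1986 Lemma 4.5 (4.38) as the scalar kernel»; dag-lead FAN-OUT v1.1 §N15 s3 «KING-MODEL RUNG … `NE2_in_KingModel` + the
one-line statement of what the curved case adds»).  `bears_on: R4∕N15`; `--supports stmt-QuantumFields-19676` (K3).  COUNT-NEUTRAL; definition lane.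

THE PRINT (template literature, PUBLISHED AND PROVED — the only printed η-rate of the node's row).  [King1986] = C. King, CMP **102** (1986) 649–677,
Lemma 4.5 (4.38) p. 674 *«|C^{(k)}(x, y) − C^{(k+n)}(x, y)| ≤ CL^{−k}e^{−δ₀|x−y|}»*, `C^{(k)} = (Δ^{(k)} + aL⁻²Q*Q)⁻¹` ((4.32) at `s = 1, 0`), proved *«in a
finite volume Ω with periodic boundary conditions»*; in the tree for King's ACTUAL operators on EVERY torus `Π_μ ℤ∕(LM_μ)` with `K₄₅(a,L,d)`, `δ₄₅(a,L,d) > 0`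
explicit: `King1986.Torus.king_lemma45_torus` (`L ≥ 2`, `k, n ≥ 1`, `a, m² > 0`).  THE NODE (K4 face `YMDAG.UVSplit.N15At`, venue `N15_NE2.lean`): the
three NE2⁺ layers of `T4EtaRate` on ONE family — [Balaban1985BackgroundPropagators] = [B9] Thm 3.1 (3.42) p. 397 ∕ Thm 3.2 (3.48) p. 398 ∕ Thm 3.15
(3.187) p. 432 are QUANTIFIER TEMPLATES only (they print uniformity in the spacing, never an η-difference; NE2⁺ is NOT PRINTED, NOT PROVED for Bałaban).

CONTENTS (0 sorry; part 2∕2 — the carriers are part 1∕2 `BalabanUVNodesN15KingModelCarriers`: index `KingIndex d L` = (torus `M_μ ≥ 1` blocks of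
side `L`, `k ≥ 1`, shift `n ≥ 1`, direction `ν`, and the [B9] size parameter as a FREE coordinate `Msz ≥ 1` — no referent in King's model; carried free
so that the by-name guard `M₅ ≤ M` is LIVE and not the reason the shapes hold, ref-B READ-323∕335 A2), one-scale carrier `kingGeo` (unit lattice,
`tdistT`, `η = L^{−k}`, `L^kη = 1`, `M := Msz`), [B9] geometries = n15-b's `N15.OperatorReadout.opGeo` with the argument sort REALISED, η-pairing = shift
`n` and the IDENTITY on sites and arguments, one-point backgrounds `pt9Bg`; `kingCov` BY NAME, `kingDefect = 𝔇(C^{(k+n)}, C^{(k)})`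
(`T4EtaRateDefect.idef id id`), the `U ≡ 1` unit-lattice derivatives, the four (3.42) entry operators `kingOps = ![𝔇, ∇_ν𝔇, 𝔇∇_ν*, Δ𝔇]`, `kingOp`
(n15-b's `opFamily`), the kernel `kingKer`, `kingDist`, `kingB0 = 4(d+1)e^{δ₄₅}(K₄₅+1)`).  HERE: §2b the point-source entries `kingOps_single_le` (all four
`≤ B₀^K·L^{−k}·e^{−δ₄₅|x−z|_T}`: (4.38) + «a unit step moves the torus distance by ≤ 1»).  §3 operator layer: `hasMaj_kingOps` (n15-a's
`N15.DefectKernel.hasMaj_ofBlocks_of_entry_le`), **`etaRateIneq342_king`** (EVERY index, NO guard; n15-b's `etaRateIneq342_of_hasMaj`),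
`ne2ZeroOperator_king`, **`ne2PlusOperator_king`**.  §4 site ∕ unit layers on the same kernel: `etaRateIneqSite_king`, `ne2PlusSite_king`,
`ne2ZeroSite_king`; `etaRateIneqUnit_king` = (4.38) ITSELF in the unit-layer vocabulary (`θ = L⁻¹`), **`ne2PlusUnit_king`**, `ne2ZeroUnit_king`.
§5 **`n15At_kingModel`** (= NE2_in_KingModel): `N15At (kingCarriers d L a m2 c35 p)` for every `d`, `L ≥ 2`, `a, m² > 0`, `c35`, `p`; `n15At_kingModel_dim4`;
`kingCarriers_index_nonempty` (the empty-index triviality located by `N15AtSpineCarriers.n15At_of_isEmpty` does not apply).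

WHAT THE CURVED CASE ADDS (the one line).  A background carrier with (3.35)–(3.36) LIVE and King's four leaves `U`-dependent, uniformly over the
regular backgrounds: (H1) coercivity (4.33) ← [B9] Thm 3.15's lower bound, (H2)∕(H2′) decay (4.34) ← (3.187), (H4) volume sums ← [B6] Lemma 2.1 (2.61)
— printed KIND — and (H3) the two-spacing sup-rate of `Δ^{(k)}(U)` ← NOT PRINTED (N16 ∕ NE3's `LocalRate`, the `hNE3` binder); the typed socket from
exactly these leaves to `NE2PlusUnit` on ANY background family is n15-a's `BalabanUVNodesN15Knit.N15unit_of_kingLeaves` (cited, not restated); the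
operator ∕ site layers with background need NODE 00's multiscale `𝔅` besides.

HONEST FRAMING ∕ LIMITS.  King's `A = 0` SCALAR MODEL — NOT Bałaban's `C^{(k)}(Λ; U)`, `G(U)`, `H(U)`; operator and site layers READ on the
unit-lattice covariance (no tree η-rate in kernel×kernel form for King's site-layer analogues `(Q_kG_kQ_k*)⁻¹` ∕ `ℋ_k` — NOT COVERED); periodic b.c.;
`k ≥ 1` (`a_k` undefined at `k = 0`); Hölder ∕ L² ∕ global sorts inert.  NOT vacuous: index inhabited at every `k ≥ 1`; guards `M₅ ≤ Msz`, `0 < α₀`,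
`Msz·α₀ ≤ a₀` met at every `(M, k, n, ν)` (`Msz = α₀ = 1`) and the guard-free content is displayed; rate `L^{−k}`, decay `δ₄₅`, uniformity in
`(k, n, M, m²)` genuine.  NOT a node discharge (carriers of record = NODE 00's); typed 28∕28, discharged count untouched; one finite torus programme
at fixed ε — NOT ℝ⁴ ∕ infinite volume ∕ OS ∕ mass gap ∕ Clay.  Locators only: [King1986] p. 664, (4.32)–(4.34), (4.38) p. 674; [B9] (3.35) p. 396,
(3.42) p. 397, (3.48) p. 398, (3.187) p. 432; [B6] = [Balaban1984PropagatorsII] Lemma 2.1 (2.61) p. 234.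
-/

noncomputable section

open scoped BigOperators
open Finset

namespace Summit.QuantumFields.YangMills.BalabanUVNodes.N15.KingModel

open Literature.MathematicalPhysics.QuantumFieldTheory.Balaban1983to89
open Literature.MathematicalPhysics.QuantumFieldTheory.Balaban1983to89.B11SectG (BlockNorm HasMaj)
open Literature.MathematicalPhysics.QuantumFieldTheory.Balaban1983to89.T4EtaRate (PairedInstance EtaRateIneq342 EtaRateIneqSite EtaRateIneqUnit
  NE2PlusOperator NE2ZeroOperator NE2PlusSite NE2PlusUnit rateFactor)
open Literature.MathematicalPhysics.QuantumFieldTheory.Balaban1983to89.T4EtaRateDefectSite (pt9Bg)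
open Literature.MathematicalPhysics.QuantumFieldTheory.Balaban1983to89.T4EtaRateCoeffDefect (fibre mem_fibre)
open Literature.MathematicalPhysics.QuantumFieldTheory.Balaban1983to89.T4EtaRateSiteOfRatePair (NE2ZeroSite)
open Literature.MathematicalPhysics.QuantumFieldTheory.Balaban1983to89.T4EtaRateUnitWitness (NE2ZeroUnit ne2ZeroUnit_of_ne2PlusUnit)
open Literature.MathematicalPhysics.QuantumFieldTheory.Balaban1983to89.B5Prop11Plancherel (Tor fine unitVec)
open Literature.MathematicalPhysics.QuantumFieldTheory.King1986.Torus (tdistT K45 delta45 K45_nonneg delta45_pos king_lemma45_torus)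
open Summit.QuantumFields.YangMills.BalabanUVNodes.N15.OperatorReadout (opGeo opFamily opGeo_len rateFactor_opGeo etaRateIneq342_of_hasMaj)
open Summit.QuantumFields.YangMills.BalabanUVNodes.N15.DefectKernel (hasMaj_ofBlocks_of_entry_le)
open YMDAG.UVSplit (NE2Carriers N15At)

variable {d : ℕ} {L : ℕ} [NeZero L]

/-! ## §2b The point-source entries of the four entry operators (Lemma 4.5 + unit shifts) -/

section Entries

variable {a m2 : ℝ}


/-- **LEMMA 4.5 AT AN INDEX** (King's theorem BY NAME, sides swapped): `|C^{(k+n)}(x, z) − C^{(k)}(x, z)| ≤ K₄₅·L^{−k}·e^{−δ₄₅|x−z|_T}` on the index's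
torus (`L ≥ 2`, `a, m² > 0`; `k, n ≥ 1` are the index's). [cite: King1986, Lemma 4.5 (4.38) p.674] -/
theorem kingKer_abs_le (ha : 0 < a) (hm : 0 < m2) (hL : 2 ≤ L) (i : KingIndex d L) (x z : Tor (kingTor i)) :
    |kingCov L i.Mn a m2 (L ^ i.n * L ^ i.k) (i.k + i.n) x z - kingCov L i.Mn a m2 (L ^ i.k) i.k x z|
      ≤ K45 (d + 1) a L * ((L : ℝ) ^ i.k)⁻¹ * Real.exp (-(delta45 (d + 1) a L * tdistT (kingTor i) x z)) := by
  rw [abs_sub_comm]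
  exact king_lemma45_torus (d := d + 1) ha hm hL i.one_le_k i.one_le_n i.Mn x z

/-- The (4.38) majorant with the padded constant `K₄₅ + 1` and a shift allowance: for `δ = δ₄₅`, `K·L^{−k}·e^{−δt} ≤ (K₄₅+1)·L^{−k}·e^{−δt}`, and the
basic majorant is non-negative. [folklore] -/
theorem kingKer_abs_le' (ha : 0 < a) (hm : 0 < m2) (hL : 2 ≤ L) (i : KingIndex d L) (x z : Tor (kingTor i)) :
    |kingCov L i.Mn a m2 (L ^ i.n * L ^ i.k) (i.k + i.n) x z - kingCov L i.Mn a m2 (L ^ i.k) i.k x z|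
      ≤ (K45 (d + 1) a L + 1) * ((L : ℝ) ^ i.k)⁻¹ * Real.exp (-(delta45 (d + 1) a L * tdistT (kingTor i) x z)) := by
  refine (kingKer_abs_le ha hm hL i x z).trans ?_
  have hLk : 0 ≤ ((L : ℝ) ^ i.k)⁻¹ := by positivity
  gcongr
  linarith

/-- **THE FOUR POINT-SOURCE ENTRIES** of the King entry operators are bounded by `B₀^K·L^{−k}·e^{−δ₄₅|x−z|_T}`, uniformly in the index
(`L ≥ 2`, `a, m² > 0`): entry 0 is (4.38); entries 1–3 are sums of at most `2(d+1)` unit-shifted copies of it. [cite: King1986, Lemma 4.5 (4.38) p.674; Balaban1985BackgroundPropagators, (3.42) p.397 (shape)] -/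
theorem kingOps_single_le (ha : 0 < a) (hm : 0 < m2) (hL : 2 ≤ L) (i : KingIndex d L) (m : Fin 4) (U : Unit)
    (x z : Tor (kingTor i)) : |kingOps a m2 i m U (Pi.single z 1) x|
      ≤ kingB0 d a L * ((L : ℝ) ^ i.k)⁻¹ * Real.exp (-(delta45 (d + 1) a L * tdistT (kingTor i) x z)) := by
  -- notation
  set δ := delta45 (d + 1) a L with hδdef
  set Kc := (K45 (d + 1) a L + 1) * ((L : ℝ) ^ i.k)⁻¹ with hKc
  have hδ0 : 0 ≤ δ := (delta45_pos (d := d + 1) ha hL).le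
  have hK0 : 0 ≤ K45 (d + 1) a L := K45_nonneg (d := d + 1) a L
  have hKc0 : 0 ≤ Kc := by rw [hKc]; positivity
  have hE1 : 1 ≤ Real.exp δ := Real.one_le_exp hδ0
  set E := fun y : Tor (kingTor i) => Real.exp (-(δ * tdistT (kingTor i) y z)) with hEdef
  have hE0 : ∀ y, 0 ≤ E y := fun y => Real.exp_nonneg _
  -- the basic bound and its shifted forms
  have hb : ∀ y, |kingDefect a m2 i (Pi.single z 1) y| ≤ Kc * E y := fun y => by
    rw [kingDefect_single]; exact kingKer_abs_le' ha hm hL i y z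
  have hb_add : ∀ (y) (μ : Fin (d + 1)), |kingDefect a m2 i (Pi.single z 1) (y + unitVec (kingTor i) μ)| ≤ Kc * (Real.exp δ * E y) :=
    fun y μ => (hb _).trans (mul_le_mul_of_nonneg_left (exp_shift_add_le (kingTor i) hδ0 y z μ) hKc0)
  have hb_sub : ∀ (y) (μ : Fin (d + 1)), |kingDefect a m2 i (Pi.single z 1) (y - unitVec (kingTor i) μ)| ≤ Kc * (Real.exp δ * E y) :=
    fun y μ => (hb _).trans (mul_le_mul_of_nonneg_left (exp_shift_sub_le (kingTor i) hδ0 y z μ) hKc0)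
  have hb_src : ∀ (y) (μ : Fin (d + 1)), |kingDefect a m2 i (Pi.single (z + unitVec (kingTor i) μ) 1) y| ≤ Kc * (Real.exp δ * E y) :=
    fun y μ => by
      rw [kingDefect_single]
      exact (kingKer_abs_le' ha hm hL i y _).trans
        (mul_le_mul_of_nonneg_left (exp_shift_source_le (kingTor i) hδ0 y z μ) hKc0)
  -- the target constant dominates `2(d+1)e^δ·Kc` and `Kc`
  have hd1 : (1 : ℝ) ≤ (d : ℝ) + 1 := by
    have : (0 : ℝ) ≤ d := Nat.cast_nonneg d
    linarith
  have htarget : kingB0 d a L * ((L : ℝ) ^ i.k)⁻¹ * E x = 4 * ((d : ℝ) + 1) * Real.exp δ * (Kc * E x) := by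
    simp only [kingB0, hKc, hδdef]; ring
  rw [htarget]
  -- bookkeeping inequalities between the majorant sizes
  set P := Kc * E x with hP
  set R := Real.exp δ * P with hR
  have hP0 : 0 ≤ P := mul_nonneg hKc0 (hE0 x)
  have hPR : P ≤ R := le_mul_of_one_le_left hP0 hE1
  have hR0 : 0 ≤ R := hP0.trans hPR
  have hKcR : Kc * (Real.exp δ * E x) = R := by rw [hR, hP]; ring
  have hT : 4 * ((d : ℝ) + 1) * Real.exp δ * (Kc * E x) = 4 * ((d : ℝ) + 1) * R := by rw [hR, hP]; ring
  have h4R : 4 * R ≤ 4 * ((d : ℝ) + 1) * R := by nlinarith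
  rw [hT]
  obtain ⟨⟩ := U
  fin_cases m
  · -- entry 0: 𝔇 itself
    show |kingDefect a m2 i (Pi.single z 1) x| ≤ _
    have h2 := hb x
    linarith
  · -- entry 1: ∇_ν𝔇
    show |(fwdDiff (kingTor i) i.ν ∘ₗ kingDefect a m2 i) (Pi.single z 1) x| ≤ _
    rw [LinearMap.comp_apply, fwdDiff_apply]
    refine (abs_sub _ _).trans ?_
    have h1 := hb_add x i.ν
    have h2 := hb x
    rw [hKcR] at h1
    linarith
  · -- entry 2: 𝔇∇_ν*
    show |(kingDefect a m2 i ∘ₗ adjDiff (kingTor i) i.ν) (Pi.single z 1) x| ≤ _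
    rw [LinearMap.comp_apply, adjDiff_single, map_sub, Pi.sub_apply]
    refine (abs_sub _ _).trans ?_
    have h1 := hb_src x i.ν
    have h2 := hb x
    rw [hKcR] at h1
    linarith
  · -- entry 3: Δ𝔇
    show |(lapOp (kingTor i) ∘ₗ kingDefect a m2 i) (Pi.single z 1) x| ≤ _
    rw [LinearMap.comp_apply, lapOp_apply]
    refine (Finset.abs_sum_le_sum_abs _ _).trans ?_
    have hterm : ∀ μ : Fin (d + 1),
        |kingDefect a m2 i (Pi.single z 1) (x + unitVec (kingTor i) μ) + kingDefect a m2 i (Pi.single z 1) (x - unitVec (kingTor i) μ)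
            - 2 * kingDefect a m2 i (Pi.single z 1) x| ≤ 4 * R := fun μ => by
      have h1 := hb_add x μ
      have h2 := hb_sub x μ
      have h3 := hb x
      rw [hKcR] at h1 h2
      calc _ ≤ |kingDefect a m2 i (Pi.single z 1) (x + unitVec (kingTor i) μ) + kingDefect a m2 i (Pi.single z 1) (x - unitVec (kingTor i) μ)|
              + |2 * kingDefect a m2 i (Pi.single z 1) x| := abs_sub _ _
        _ ≤ (|kingDefect a m2 i (Pi.single z 1) (x + unitVec (kingTor i) μ)| + |kingDefect a m2 i (Pi.single z 1) (x - unitVec (kingTor i) μ)|)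
              + 2 * |kingDefect a m2 i (Pi.single z 1) x| := by
            refine add_le_add (abs_add_le _ _) (le_of_eq ?_)
            rw [abs_mul, abs_two]
        _ ≤ 4 * R := by linarith
    calc ∑ μ : Fin (d + 1), |kingDefect a m2 i (Pi.single z 1) (x + unitVec (kingTor i) μ)
            + kingDefect a m2 i (Pi.single z 1) (x - unitVec (kingTor i) μ) - 2 * kingDefect a m2 i (Pi.single z 1) x|
        ≤ ∑ _μ : Fin (d + 1), 4 * R := Finset.sum_le_sum fun μ _ => hterm μ
      _ = 4 * ((d : ℝ) + 1) * R := by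
          rw [Finset.sum_const, Finset.card_univ, Fintype.card_fin, nsmul_eq_mul]; push_cast; ring

end Entries

/-! ## §3 The operator layer: block majorants, `EtaRateIneq342` guard-free, `NE2ZeroOperator` ∕ `NE2PlusOperator` BY NAME -/

section OperatorLayer

variable {a m2 : ℝ}

/-- With every site its own block, each fibre of the site assignment is a singleton. [folklore] -/
theorem card_fibre_self_le_one {X : Type} [Fintype X] [DecidableEq X] (y : X) : (fibre (fun x : X => x) y).card ≤ 1 :=
  Finset.card_le_one.mpr fun a ha b hb => by
    rw [mem_fibre] at ha hb
    rw [ha, hb]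

/-- **BLOCK MAJORANTS OF THE FOUR ENTRY OPERATORS** (point blocks on the King carrier): each `T_m` has the majorant `B₀^K·L^{−k}·e^{−δ₄₅|y−y′|_T}`
between the sharp cube norms — n15-a's `hasMaj_ofBlocks_of_entry_le` on §2's point-source entries. [cite: King1986, Lemma 4.5 (4.38) p.674; Balaban1985BackgroundPropagators, (3.42) p.397 (shape)] -/
theorem hasMaj_kingOps (ha : 0 < a) (hm : 0 < m2) (hL : 2 ≤ L) (i : KingIndex d L) (m : Fin 4) (U : Unit) :
    HasMaj (BlockNorm.ofBlocks (kingGeo L i.k (kingTor i) i.Msz) (fun x => x))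
      (BlockNorm.ofBlocks (kingGeo L i.k (kingTor i) i.Msz) (fun x => x)) (kingOps a m2 i m U)
      (fun y y' => kingB0 d a L * ((L : ℝ) ^ i.k)⁻¹ * Real.exp (-(delta45 (d + 1) a L * tdistT (kingTor i) y y'))) := by
  have hB : 0 ≤ kingB0 d a L := (kingB0_pos d a L).le
  have key := hasMaj_ofBlocks_of_entry_le (g := kingGeo L i.k (kingTor i) i.Msz) (fun x => x) (fun x => x)
    (T := kingOps a m2 i m U)
    (κ := fun y y' => kingB0 d a L * ((L : ℝ) ^ i.k)⁻¹ * Real.exp (-(delta45 (d + 1) a L * tdistT (kingTor i) y y')))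
    (n₀ := 1) (fun _ _ => by positivity) (fun y' => card_fibre_self_le_one y')
    (fun x z => kingOps_single_le ha hm hL i m U x z)
  exact key.mono fun y y' => by push_cast; rw [one_mul]

/-- **THE OPERATOR LAYER, GUARD-FREE CONTENT**: for EVERY index and (the) configuration, King's entry family satisfies `T4EtaRate.EtaRateIneq342`
with the UNIFORM constants `(B₀, δ₀, γ) = (B₀^K, δ₄₅, 1)` (`L ≥ 2`, `a, m² > 0`) — every site has physical size `1`, so the (3.42) prefactors are
`1` and the max-rate-factor is `(L^k)⁻¹`.  No `M₅ ≤ M` guard is used. [cite: King1986, Lemma 4.5 (4.38) p.674; Balaban1985BackgroundPropagators, Thm 3.1 (3.42) p.397 (shape)] -/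
theorem etaRateIneq342_king (ha : 0 < a) (hm : 0 < m2) (hL : 2 ≤ L) (i : KingIndex d L) (U : Unit) :
    EtaRateIneq342 (kingOp a m2 i) (kingB0 d a L) (delta45 (d + 1) a L) 1 U := by
  have hLpos : (0 : ℝ) < L := by exact_mod_cast (show 0 < L by omega)
  have hη : 0 < (kingGeo L i.k (kingTor i) i.Msz).eta := by
    show 0 < (((L : ℝ) ^ i.k))⁻¹; positivity
  have hB : 0 ≤ kingB0 d a L := (kingB0_pos d a L).le
  -- the (3.42) shape at unit scale: prefactor 1, max-rate-factor (L^k)⁻¹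
  have hlen : ∀ y : Tor (kingTor i), (opGeo (kingGeo L i.k (kingTor i) i.Msz) (Tor (kingTor i)) (fun x => x)).len y = 1 := fun y => by
    rw [opGeo_len]; exact kingGeo_len (NeZero.ne L) i.k (kingTor i) i.Msz y
  have hrf : ∀ w : Tor (kingTor i), rateFactor (opGeo (kingGeo L i.k (kingTor i) i.Msz) (Tor (kingTor i)) (fun x => x)) 1 w
      = ((L : ℝ) ^ i.k)⁻¹ := fun w => by
    rw [rateFactor_opGeo _ _ _ hη.ne' hLpos, T4EtaRateDefect.rateWeight]
    show ((L : ℝ) ^ i.k) ^ (-(1 : ℝ)) = ((L : ℝ) ^ i.k)⁻¹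
    exact Real.rpow_neg_one _
  have hpref : ∀ m : Fin 4, B9.pref4 (1 : ℝ) m = 1 := fun m => by
    fin_cases m <;> simp [B9.pref4]
  have key : ∀ m : Fin 4, HasMaj (BlockNorm.ofBlocks (kingGeo L i.k (kingTor i) i.Msz) (fun x => x))
      (BlockNorm.ofBlocks (kingGeo L i.k (kingTor i) i.Msz) (fun x => x)) (kingOps a m2 i m U)
      (fun y y' => kingB0 d a L * B9.pref4 ((opGeo (kingGeo L i.k (kingTor i) i.Msz) (Tor (kingTor i)) (fun x => x)).len y) m
        * Real.exp (-(delta45 (d + 1) a L * (kingGeo L i.k (kingTor i) i.Msz).dist y y'))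
        * max (rateFactor (opGeo (kingGeo L i.k (kingTor i) i.Msz) (Tor (kingTor i)) (fun x => x)) 1 y)
            (rateFactor (opGeo (kingGeo L i.k (kingTor i) i.Msz) (Tor (kingTor i)) (fun x => x)) 1 y')) := fun m => by
    refine (hasMaj_kingOps ha hm hL i m U).mono fun y y' => le_of_eq ?_
    rw [hlen, hpref, hrf, hrf, max_self]
    show _ = kingB0 d a L * 1 * Real.exp (-(delta45 (d + 1) a L * tdistT (kingTor i) y y')) * ((L : ℝ) ^ i.k)⁻¹
    ring
  exact etaRateIneq342_of_hasMaj (g := kingGeo L i.k (kingTor i) i.Msz) (B := pt9Bg) (fun x => x) (fun x => x) hη.le hLpos.le hB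
    (kingOps a m2 i) U key

/-- **`NE2ZeroOperator` FOR KING'S COVARIANCES, BY NAME** (`L ≥ 2`, `a, m² > 0`): `(M₅, δ₀, B₀, γ) = (1, δ₄₅, B₀^K, 1)`; the guard `1 ≤ Msz` holds at
EVERY index (it is a field of the index), so nothing is vacuous. [cite: King1986, Lemma 4.5 (4.38) p.674 and Props. 3.8–3.9 pp.664–665 (A = 0 model)] -/
theorem ne2ZeroOperator_king (ha : 0 < a) (hm : 0 < m2) (hL : 2 ≤ L) :
    NE2ZeroOperator (kingInstance (d := d) (L := L)) (kingOp a m2) :=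
  ⟨1, delta45 (d + 1) a L, kingB0 d a L, 1, one_pos, delta45_pos (d := d + 1) ha hL, kingB0_pos d a L, one_pos,
    fun i _ => etaRateIneq342_king ha hm hL i ()⟩

/-- **`NE2PlusOperator` FOR KING'S COVARIANCES, BY NAME** (every `c35`; `L ≥ 2`, `a, m² > 0`): `(M₅, δ₀, a₀, B₀, γ) = (1, δ₄₅, 1, B₀^K, 1)`.  HONEST
SCOPE: the background block ranges over the one-point carrier (`A = 0` is King's model — NE2⁰ content inside NE2⁺'s TYPE); the guards are met at every
index; the content is `etaRateIneq342_king`. [cite: Balaban1985BackgroundPropagators, Thm 3.1 p.397 (quantifier template); King1986, Lemma 4.5 (4.38) p.674] -/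
theorem ne2PlusOperator_king (ha : 0 < a) (hm : 0 < m2) (hL : 2 ≤ L) (c35 : ℝ) :
    NE2PlusOperator c35 (kingInstance (d := d) (L := L)) (kingOp a m2) :=
  ⟨1, delta45 (d + 1) a L, 1, kingB0 d a L, 1, one_pos, delta45_pos (d := d + 1) ha hL, one_pos, kingB0_pos d a L, one_pos,
    fun i _ _ _ _ U _ => etaRateIneq342_king ha hm hL i U⟩

end OperatorLayer

/-! ## §4 The site and unit layers on the same kernel -/

section SiteUnit

variable {a m2 : ℝ}

/-- **THE SITE LAYER, GUARD-FREE CONTENT**: for every index, configuration, `d′` and `p`, `EtaRateIneqSite d′ p (kingKer i) (K₄₅+1) δ₄₅ 1` — at unit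
scale `(L^jη)^{−p} = (L^{j′}η)^{−d′} = 1` and the max-rate-factor is `(L^k)⁻¹`. [cite: King1986, Lemma 4.5 (4.38) p.674; Balaban1985BackgroundPropagators, Thm 3.2 (3.48) p.398 (shape)] -/
theorem etaRateIneqSite_king (ha : 0 < a) (hm : 0 < m2) (hL : 2 ≤ L) (i : KingIndex d L) (U : Unit) (d' : ℕ) (p : ℝ) :
    EtaRateIneqSite d' p (kingKer a m2 i) (K45 (d + 1) a L + 1) (delta45 (d + 1) a L) 1 U := by
  have hLpos : (0 : ℝ) < L := by exact_mod_cast (show 0 < L by omega)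
  have hη : 0 < (kingGeo L i.k (kingTor i) i.Msz).eta := by
    show 0 < (((L : ℝ) ^ i.k))⁻¹; positivity
  intro y y'
  have hlen : ∀ w : Tor (kingTor i), (kingInstance (d := d) (L := L) i).gc.len w = 1 := fun w =>
    kingGeo_len (NeZero.ne L) i.k (kingTor i) i.Msz w
  have hrf : ∀ w : Tor (kingTor i), rateFactor (kingInstance (d := d) (L := L) i).gc 1 w = ((L : ℝ) ^ i.k)⁻¹ := fun w => by
    show rateFactor (opGeo (kingGeo L i.k (kingTor i) i.Msz) (Tor (kingTor i)) (fun x => x)) 1 w = _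
    rw [rateFactor_opGeo _ _ _ hη.ne' hLpos, T4EtaRateDefect.rateWeight]
    show ((L : ℝ) ^ i.k) ^ (-(1 : ℝ)) = ((L : ℝ) ^ i.k)⁻¹
    exact Real.rpow_neg_one _
  rw [hlen, hlen, hrf, hrf, max_self, Real.one_rpow, Real.one_rpow, mul_one, mul_one]
  calc |(kingKer a m2 i).ker U y y'|
      = |kingCov L i.Mn a m2 (L ^ i.n * L ^ i.k) (i.k + i.n) y y' - kingCov L i.Mn a m2 (L ^ i.k) i.k y y'| := rfl
    _ ≤ (K45 (d + 1) a L + 1) * ((L : ℝ) ^ i.k)⁻¹ * Real.exp (-(delta45 (d + 1) a L * tdistT (kingTor i) y y')) :=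
        kingKer_abs_le' ha hm hL i y y'
    _ = (K45 (d + 1) a L + 1) * Real.exp (-(delta45 (d + 1) a L * tdistT (kingTor i) y y')) * ((L : ℝ) ^ i.k)⁻¹ := by ring

/-- **`NE2PlusSite` FOR KING'S COVARIANCE KERNEL, BY NAME** (every `d′`, `p`, `c35`; `L ≥ 2`, `a, m² > 0`): `(M₅, δ, a₀, C, γ) = (1, δ₄₅, 1, K₄₅+1, 1)`.
HONEST SCOPE: in King's model the tree holds no kernel×kernel η-rate for the site-layer analogues `(Q_kG_kQ_k*)⁻¹` ∕ `ℋ_k`; the site layer is READ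
on the unit-lattice covariance kernel (said in the header). [cite: Balaban1985BackgroundPropagators, Thm 3.2 (3.48) p.398 (quantifier template); King1986, Lemma 4.5 (4.38) p.674] -/
theorem ne2PlusSite_king (ha : 0 < a) (hm : 0 < m2) (hL : 2 ≤ L) (d' : ℕ) (p c35 : ℝ) :
    NE2PlusSite d' p c35 (kingInstance (d := d) (L := L)) (kingKer a m2) := by
  have hK : 0 < K45 (d + 1) a L + 1 := by have := K45_nonneg (d := d + 1) a L; linarith
  exact ⟨1, delta45 (d + 1) a L, 1, K45 (d + 1) a L + 1, 1, one_pos, delta45_pos (d := d + 1) ha hL, one_pos, hK, one_pos,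
    fun i _ _ _ _ U _ => etaRateIneqSite_king ha hm hL i U d' p⟩

/-- … and the trivial-background site layer `NE2ZeroSite`. [cite: Balaban1985BackgroundPropagators, Thm 3.2 (3.48) p.398 (quantifier template); King1986, Lemma 4.5 (4.38) p.674] -/
theorem ne2ZeroSite_king (ha : 0 < a) (hm : 0 < m2) (hL : 2 ≤ L) (d' : ℕ) (p : ℝ) :
    NE2ZeroSite d' p (kingInstance (d := d) (L := L)) (kingKer a m2) := by
  have hK : 0 < K45 (d + 1) a L + 1 := by have := K45_nonneg (d := d + 1) a L; linarith
  exact ⟨1, delta45 (d + 1) a L, K45 (d + 1) a L + 1, 1, one_pos, delta45_pos (d := d + 1) ha hL, hK, one_pos,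
    fun i _ => etaRateIneqSite_king ha hm hL i () d' p⟩

/-- **THE UNIT LAYER, GUARD-FREE CONTENT = LEMMA 4.5 ITSELF in the node's vocabulary**: for every index and configuration,
`EtaRateIneqUnit (kingKer i) inΛ tdistT (K₄₅+1) δ₄₅ (L⁻¹) k` — *«|C^{(k)}(x, y) − C^{(k+n)}(x, y)| ≤ CL^{−k}e^{−δ₀|x−y|}»* with `θ = L⁻¹`, the printed
instance named in `T4EtaRate.EtaRateIneqUnit`'s docstring. [cite: King1986, Lemma 4.5 (4.38) p.674] -/
theorem etaRateIneqUnit_king (ha : 0 < a) (hm : 0 < m2) (hL : 2 ≤ L) (i : KingIndex d L) (U : Unit) :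
    EtaRateIneqUnit (kingKer a m2 i) (fun _ => True) (kingDist (d := d) (L := L) i)
      (K45 (d + 1) a L + 1) (delta45 (d + 1) a L) ((L : ℝ)⁻¹) (kingInstance (d := d) (L := L) i).gc.k U := by
  intro y y' _ _
  show |kingCov L i.Mn a m2 (L ^ i.n * L ^ i.k) (i.k + i.n) y y' - kingCov L i.Mn a m2 (L ^ i.k) i.k y y'|
    ≤ (K45 (d + 1) a L + 1) * Real.exp (-(delta45 (d + 1) a L * tdistT (kingTor i) y y')) * ((L : ℝ)⁻¹) ^ i.k
  rw [inv_pow]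
  calc _ ≤ (K45 (d + 1) a L + 1) * ((L : ℝ) ^ i.k)⁻¹ * Real.exp (-(delta45 (d + 1) a L * tdistT (kingTor i) y y')) :=
        kingKer_abs_le' ha hm hL i y y'
    _ = _ := by ring

/-- **`NE2PlusUnit` FOR KING'S `C^{(k)}`, BY NAME — «King 1986 Lemma 4.5 (4.38) as the scalar kernel»** (every `c35`; `L ≥ 2`, `a, m² > 0`):
`(δ₀, a₀, B₀, θ) = (δ₄₅, 1, K₄₅+1, L⁻¹)`, `θ < 1`.  HONEST SCOPE: backgrounds range over the one-point carrier (King's `A = 0`); rate, decay and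
uniformity in `(k, n, M, m²)` genuine. [cite: Balaban1985BackgroundPropagators, Thm 3.15 (3.187) p.432 (quantifier template); King1986, Lemma 4.5 (4.38) p.674] -/
theorem ne2PlusUnit_king (ha : 0 < a) (hm : 0 < m2) (hL : 2 ≤ L) (c35 : ℝ) :
    NE2PlusUnit c35 (kingInstance (d := d) (L := L)) (kingKer a m2) (fun _ _ => True) kingDist := by
  have hK : 0 < K45 (d + 1) a L + 1 := by have := K45_nonneg (d := d + 1) a L; linarith
  have hLr : (1 : ℝ) < L := by exact_mod_cast hL
  have hθ0 : 0 < ((L : ℝ))⁻¹ := inv_pos.mpr (by linarith)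
  have hθ1 : ((L : ℝ))⁻¹ < 1 := inv_lt_one_of_one_lt₀ hLr
  exact ⟨delta45 (d + 1) a L, 1, K45 (d + 1) a L + 1, ((L : ℝ))⁻¹, delta45_pos (d := d + 1) ha hL, one_pos, hK, hθ0, hθ1,
    fun i _ _ _ U _ _ => etaRateIneqUnit_king ha hm hL i U⟩

/-- … and the trivial-background unit layer `NE2ZeroUnit` (the lineage's bookkeeping `ne2ZeroUnit_of_ne2PlusUnit`: `Msz > 0`, (3.35)∕(3.36) hold at
the one point). [cite: King1986, Lemma 4.5 (4.38) p.674] -/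
theorem ne2ZeroUnit_king (ha : 0 < a) (hm : 0 < m2) (hL : 2 ≤ L) :
    NE2ZeroUnit (kingInstance (d := d) (L := L)) (kingKer a m2) (fun _ _ => True) kingDist :=
  ne2ZeroUnit_of_ne2PlusUnit (c35 := 0) (fun i => lt_of_lt_of_le one_pos i.one_le_Msz) (fun _ _ _ => trivial) (fun _ _ _ => trivial)
    (ne2PlusUnit_king ha hm hL 0)

end SiteUnit

/-! ## §5 `NE2_in_KingModel`: the node's K4 face `N15At` on the King carriers -/

section Node

/-- THE KING CARRIERS OF NODE N15 (route module 2's `YMDAG.UVSplit.NE2Carriers`): index `KingIndex d L`, the King family of paired instances, the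
operator-layer entry family of `𝔇(C^{(k+n)}, C^{(k)})`, the covariance kernel in BOTH the site and the unit slot, `inΛ := True`, `unitDist := tdistT`;
`c35`, `p` free. [cite: King1986, Lemma 4.5 (4.38) p.674 (the objects); Balaban1985BackgroundPropagators, Thm 3.1 p.397 + Thm 3.2 (3.48) p.398 + Thm 3.15 (3.187) p.432 (shapes)] -/
def kingCarriers (d L : ℕ) [NeZero L] (a m2 c35 p : ℝ) : NE2Carriers where
  I := KingIndex d L
  c35 := c35
  p := p
  pi := kingInstance (d := d) (L := L)
  Kop := kingOp a m2
  Ksite := kingKer a m2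
  Kunit := kingKer a m2
  inΛ := fun _ _ => True
  unitDist := kingDist

/-- **`NE2_in_KingModel` — THE NODE'S K4 FACE `N15At` IS A THEOREM ON THE KING CARRIERS** (every torus dimension `d + 1`, block factor `L ≥ 2`,
`a, m² > 0`, `c35`, `p`): `NE2PlusOperator c35 _ (𝔇(C^{(k+n)}, C^{(k)}) entries, γ = 1) ∧ NE2PlusSite 4 p c35 _ (the kernel, γ = 1) ∧ NE2PlusUnit c35 _
(the kernel, θ = L⁻¹) inΛ tdistT`, hypothesis-free, uniformly in `(k, n, M, Msz)` — NE2's analogue DECIDED in King's `A = 0` scalar model by Lemma 4.5.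
NOT Bałaban's carriers of record (NODE 00); NOT a node discharge; count-neutral. [cite: King1986, Lemma 4.5 (4.38) p.674; Balaban1985BackgroundPropagators, Thm 3.1 p.397 + Thm 3.2 (3.48) p.398 + Thm 3.15 (3.187) p.432 (quantifier templates)] -/
theorem n15At_kingModel (d : ℕ) {L : ℕ} [NeZero L] (hL : 2 ≤ L) {a m2 : ℝ} (ha : 0 < a) (hm : 0 < m2) (c35 p : ℝ) :
    N15At (kingCarriers d L a m2 c35 p) :=
  ⟨ne2PlusOperator_king ha hm hL c35, ne2PlusSite_king ha hm hL 4 p c35, ne2PlusUnit_king ha hm hL c35⟩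

/-- **THE FOUR-TORUS INSTANCE** (`d + 1 = 4`, the dimension of the T⁴ programme; `L ≥ 2`, `a, m² > 0`). [cite: King1986, Lemma 4.5 (4.38) p.674] -/
theorem n15At_kingModel_dim4 {L : ℕ} [NeZero L] (hL : 2 ≤ L) {a m2 : ℝ} (ha : 0 < a) (hm : 0 < m2) (c35 p : ℝ) :
    N15At (kingCarriers 3 L a m2 c35 p) :=
  n15At_kingModel 3 hL ha hm c35 p

/-- NON-VACUITY OF THE INDEX BLOCK: the King carriers' index type is inhabited (so `N15At` is not the empty-index triviality located by
`N15AtSpineCarriers.n15At_of_isEmpty`). [folklore] -/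
theorem kingCarriers_index_nonempty (d L : ℕ) [NeZero L] (a m2 c35 p : ℝ) :
    Nonempty (kingCarriers d L a m2 c35 p).I :=
  kingIndex_nonempty d L le_rfl

end Node

end Summit.QuantumFields.YangMills.BalabanUVNodes.N15.KingModel

end
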